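import Summits.QuantumFields.YangMills.Theorems.UnitScaleTiltProp8HalvingQuarterInterior
import Summits.QuantumFields.YangMills.Theorems.UnitScaleTiltProp8HalvingAssembly
import Summits.QuantumFields.YangMills.Theorems.UnitScaleTiltProp8HalvingDatum160
import HarnessLib

/-!
# Route `UnitScaleTilt`, crux K1 child «MinimiserStabilityRegPr» (stmt-QuantumFields-19200), registered stub V2′ `stub_halvingStep`
# (skeletons v8 5b4e846794b80374 / v10 `BirthV10`) — **THE HALVING ASSEMBLY WITH THE INTERIOR PACKAGE (THE SOCKET LIST OF RECORD FOR THE PILLAR PENS)**: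
# `stub_halvingStep` (v8∕v10 verbatim) ⟸ P2 text ∧ the analytic package whose (160)-near clause is asked ONLY on the top-level index bonds with both end-points
# in the top cube (u-free log data, [Balaban1985RegularSpaces] (1.31) first case) and whose (155)-far clause covers every other index bond (lower levels AND the
# top-level bonds crossing `∂□_k`); everything else as in `HalvingAssembly` (p595996∕p596205)

Cell `ym3-torus` (HUMAN RULING D-0037, YM ladder rung R3 — continuum SU(2) YM₃ on the torus is a RUNG, not the Clay problem), width seat
`ym-ust-19200-w3` gen 2 (D-0149).  `--supports stmt-QuantumFields-19200 --as helper`; def-free, 0 sorry, standard axioms.  LOCATED CORRECTION of this seat's own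
`HalvingAssembly.H_of_package` (see `HalvingQuarterInterior`): there the (160)-near size was asked of the crossing top-level bonds too, where only the `O(ε₀)` size
(155) of a `u`-rotated datum is available — this file's package is the satisfiable one.

WHAT THIS FILE PROVES (no definition, no sorry):
* §1 **`siteClause_of_pieces_int`** — `HalvingSiteAssembly.siteClause_of_pieces` with the interior near class (`HalvingQuarterInterior.matrixRows164_quarter_int`).
* §2 **`H_of_packageInt`** — `Prop8LastMile`'s `H(L, 4CB₀B₃, K₁ + K₂ + 1, a)` from the P2 text and the INTERIOR PACKAGE (verbatim in the statement).
* §3 **`stubText_of_packageInt_largeRho`** — the REGISTERED TEXT of `stub_halvingStep` from `∀ L > 1`: P2 text (`δ₀ > 0`) ∧ constants ∧ the interior package at every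
  radius `ρ ≥ 2` ((163) chosen here by `HalvingAssembly.exists_rho_163`); `Prop8Printed` then follows by `Prop8Iter.prop8_of_halvingLiteral`.
HONEST SCOPE: the package (P1: [B8] Thm 2 on the cube sequence with (152)–(157); P3a; F4∕P3b∕P5; the identification (156)∕(1.37) behind (160) on the interior top
bonds, `HalvingDatum160`; (155) on the rest, `HalvingFarDatum`) and the P2 text are hypotheses.  NOT a claim about the crux, the rung, or the mass gap.

References: T. Bałaban, CMP **102** (1985) 277–309 [Balaban1985Variational] (144) p.300, (152)–(159) pp.301–303, (160)–(168) pp.303–304, Prop. 8 p.304;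
CMP **99** (1985) 75–102 [Balaban1985RegularSpaces] (1.30)–(1.31) pp.81–82, (1.140)–(1.144) p.100.
-/

set_option autoImplicit false

noncomputable section

open scoped BigOperators Matrix.Norms.L2Operator

namespace Summit.QuantumFields.YangMills.Theorems.HalvingAssemblyInterior

open Literature.MathematicalPhysics.QuantumFieldTheory.Balaban1983to89
open Literature.MathematicalPhysics.QuantumFieldTheory.Balaban1983to89.T3ContinuumYM3Torus
open Literature.MathematicalPhysics.QuantumFieldTheory.Balaban1983to89.T3PrintedRegularMinimiser
open Literature.MathematicalPhysics.QuantumFieldTheory.Balaban1983to89.T3Thm1Carrier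
open Literature.MathematicalPhysics.QuantumFieldTheory.Balaban1983to89.B11 (Prop8Printed)
open Complex (I)
open B5Eq117TorusCarriers (Mk)
open B5Eq118OneStroke (iterBlockOf)
open B5Prop12FieldsLattice (distSite distSite_nonneg)
open B5RowSumsP12Lattice (distSite_comm distSite_triangle)
open B6SectADomainsV1 (Domains)
open B6SectAOperatorsV1 (BondIdx)
open B7Prop1Explicit (e expUnit)
open B7Eq92Concrete (mgauge)
open B8Ineq132 (BondTouches)
open B8Eq140Level (SideTouches Cond140)
open B8Eq143PlaqExpansion (pdiv)
open B8Eq146AExpansion (plaqCovDeriv)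
open B8Eq184Proof (cfgExp)
open B8Thm2SetupTorus (cfgPull gaugePull pullDom)
open B10Eq27TorusAxialLog (pull unitsField toUField transl)
open B11Eq115Space (levOf)
open FlatCubeOpsText (Adm22 distBI IsLevWeight IsFlatH FlatOpsAdmAtMS HDecayLetterD RowSum162)
open FlatCubeSequenceAligned (cubeSeqMT3)
open FlatCubeSequenceAdm (adm22_cubeSeqMT3)
open FlatOpsLettersAssembly (flatH isFlatH_flatH)
open HalvingQuarterInterior (matrixRows164_quarter_int)
open HalvingSiteAssembly (distSite_iterBlockOf_le_one_of_le_one dist_le_one_of_sideTouches dist_le_one_of_bondTouches)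
open Prop8PullbackLin (torusBounds_of_decomp)
open Prop8PullbackDict (localChart_top_of_torus)

/-! ## §1 The per-site clause with the interior near class -/

section Site

variable {F : T3Family} {n K : ℕ}

/-- **THE PER-SITE CLAUSE OF THE (167)-CHART SCHEMA FROM THE PIECES OF (159), INTERIOR NEAR CLASS** — see the module docstring.  The conclusion is LITERALLY the
`∃ Ω u A, x ∈ Ω k ∧ … ∧ [chart ∀ j ≤ k] ∧ [Cond140 ∀ j ≤ k]` clause of `Prop8LastMile.halvingMinimisers_of_localCharts167`'s hypothesis `H` at the site `x`
and the threshold `α₂`. [cite: Balaban1985Variational, (159) p.303, (164)-(168) p.304; Balaban1985RegularSpaces, (1.140) p.100] -/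
theorem siteClause_of_pieces_int (hnK : n < K) (x : Site (F.P K) 0) (ρ S M : ℕ) (hM : 1 ≤ M)
    {dBI : PBond (F.P K) 0 → BondIdx (cubeSeqMT3 F n K x ρ S M hM) → ℝ} {w : ℕ → PBond (F.P K) 0 → ℝ}
    {δ₀ B₀ B₃ C C₁ C₂ ε₁ ε₀ R₁M₁ e₁ e₃ α₂ : ℝ}
    (hw : IsLevWeight F n K (cubeSeqMT3 F n K x ρ S M hM) w)
    (hdom : ∀ b c, distBI (cubeSeqMT3 F n K x ρ S M hM) b c ≤ dBI b c)
    (hH : HDecayLetterD F n K (cubeSeqMT3 F n K x ρ S M hM) dBI w (flatH F n K (cubeSeqMT3 F n K x ρ S M hM)) B₀ δ₀)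
    (h162 : RowSum162 F n K (cubeSeqMT3 F n K x ρ S M hM) dBI w δ₀ B₃)
    (hδ₀ : 0 ≤ δ₀) (hB₀ : 0 ≤ B₀) (hB₃ : 0 ≤ B₃) (hC₁ : 0 ≤ C₁) (hC₁C : 2 * C₁ ≤ C) (hC₂C : C₂ ≤ C) (hε₁ : 0 ≤ ε₁) (hε₀ : 0 ≤ ε₀)
    (hR : 0 ≤ R₁M₁) (h163 : 4 * C * B₀ * B₃ * Real.exp (-(δ₀ / 2 * R₁M₁)) ≤ 1 / 2) (hρ : R₁M₁ ≤ (ρ : ℝ) - 2)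
    (hα₂ : e₁ + 1 / 4 * max (4 * C * B₀ * B₃ * ε₁) (ε₀ / 2) + e₃ < α₂)
    (U : GaugeField (F.P K) 0 (Matrix.specialUnitaryGroup (Fin 2) ℂ)) (u : GaugeTransf (F.P K) 0 (Matrix.unitaryGroup (Fin 2) ℂ))
    {A A₁ 𝔄 R : PBond (F.P K) 0 → Matrix (Fin 2) (Fin 2) ℂ} {B : BondIdx (cubeSeqMT3 F n K x ρ S M hM) → Matrix (Fin 2) (Fin 2) ℂ}
    (hA : ∀ b : PBond (F.P K) 0, IsSelfAdjoint (A b))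
    (hchart : ∀ (z : B7Prop1Explicit.Site (F.P K).d) (μ : Fin (F.P K).d),
      SideTouches (pullDom (fun j => if K - n ≤ j then ({x} : Set (Site (F.P K) 0)) else (∅ : Set (Site (F.P K) 0))) (K - n)) z μ →
      (Unitary.toUnits (u (transl 0 z)))⁻¹ * unitsField (toUField U) ⟨transl 0 z, μ⟩ * Unitary.toUnits (u ((transl 0 z).shift μ)) =
        expUnit (I • ((((F.L : ℝ)⁻¹) ^ (K - n)) • A ⟨transl 0 z, μ⟩)))
    (h𝔄 : ∀ b, 𝔄 b = ∑ c, flatH F n K (cubeSeqMT3 F n K x ρ S M hM) (Pi.single c 1) b • B c) (hdec : A = A₁ + 𝔄 - R)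
    (hnear : ∀ c : BondIdx (cubeSeqMT3 F n K x ρ S M hM), (c.1.1 : ℕ) = K - n →
      c.1.2.src ∈ (cubeSeqMT3 F n K x ρ S M hM).Om (c.1.1 : ℕ) → c.1.2.tgt ∈ (cubeSeqMT3 F n K x ρ S M hM).Om (c.1.1 : ℕ) →
      ‖B c‖ ≤ C₁ * ε₁ * (distSite (Mk (F.P K) (c.1.1 : ℕ)) c.1.2.src (iterBlockOf (c.1.1 : ℕ) x) + 1))
    (hfar : ∀ c : BondIdx (cubeSeqMT3 F n K x ρ S M hM),
      ¬ ((c.1.1 : ℕ) = K - n ∧ c.1.2.src ∈ (cubeSeqMT3 F n K x ρ S M hM).Om (c.1.1 : ℕ) ∧ c.1.2.tgt ∈ (cubeSeqMT3 F n K x ρ S M hM).Om (c.1.1 : ℕ)) →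
      ‖B c‖ ≤ C₂ * ε₀ * (F.L : ℝ) ^ ((K - n) - (c.1.1 : ℕ)))
    (s₁ : ∀ (z : B7Prop1Explicit.Site (F.P K).d) (τ : Fin (F.P K).d),
      SideTouches (pullDom (fun j => if K - n ≤ j then ({x} : Set (Site (F.P K) 0)) else (∅ : Set (Site (F.P K) 0))) (K - n)) z τ →
      ‖A₁ ⟨transl 0 z, τ⟩‖ ≤ e₁)
    (g₁ : ∀ (z : B7Prop1Explicit.Site (F.P K).d) (κ τ : Fin (F.P K).d),
      SideTouches (pullDom (fun j => if K - n ≤ j then ({x} : Set (Site (F.P K) 0)) else (∅ : Set (Site (F.P K) 0))) (K - n)) z τ →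
      ‖(((F.L : ℝ)⁻¹) ^ (K - n))⁻¹ • (A₁ ⟨(transl 0 z).shift κ, τ⟩ - A₁ ⟨transl 0 z, τ⟩)‖ ≤ e₁)
    (d₁ : ∀ (z : B7Prop1Explicit.Site (F.P K).d) (μ : Fin (F.P K).d),
      BondTouches (pullDom (fun j => if K - n ≤ j then ({x} : Set (Site (F.P K) 0)) else (∅ : Set (Site (F.P K) 0))) (K - n)) z μ →
      ‖pdiv (((F.L : ℝ)⁻¹) ^ (K - n)) (1 : B7Prop1Explicit.Site (F.P K).d → Fin (F.P K).d → (Matrix (Fin 2) (Fin 2) ℂ)ˣ)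
          (plaqCovDeriv (((F.L : ℝ)⁻¹) ^ (K - n)) (1 : B7Prop1Explicit.Site (F.P K).d → Fin (F.P K).d → (Matrix (Fin 2) (Fin 2) ℂ)ˣ)
            (pull A₁ 0)) μ z‖ ≤ e₁)
    (s₃ : ∀ (z : B7Prop1Explicit.Site (F.P K).d) (τ : Fin (F.P K).d),
      SideTouches (pullDom (fun j => if K - n ≤ j then ({x} : Set (Site (F.P K) 0)) else (∅ : Set (Site (F.P K) 0))) (K - n)) z τ →
      ‖R ⟨transl 0 z, τ⟩‖ ≤ e₃)
    (g₃ : ∀ (z : B7Prop1Explicit.Site (F.P K).d) (κ τ : Fin (F.P K).d),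
      SideTouches (pullDom (fun j => if K - n ≤ j then ({x} : Set (Site (F.P K) 0)) else (∅ : Set (Site (F.P K) 0))) (K - n)) z τ →
      ‖(((F.L : ℝ)⁻¹) ^ (K - n))⁻¹ • (R ⟨(transl 0 z).shift κ, τ⟩ - R ⟨transl 0 z, τ⟩)‖ ≤ e₃)
    (d₃ : ∀ (z : B7Prop1Explicit.Site (F.P K).d) (μ : Fin (F.P K).d),
      BondTouches (pullDom (fun j => if K - n ≤ j then ({x} : Set (Site (F.P K) 0)) else (∅ : Set (Site (F.P K) 0))) (K - n)) z μ →
      ‖pdiv (((F.L : ℝ)⁻¹) ^ (K - n)) (1 : B7Prop1Explicit.Site (F.P K).d → Fin (F.P K).d → (Matrix (Fin 2) (Fin 2) ℂ)ˣ)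
          (plaqCovDeriv (((F.L : ℝ)⁻¹) ^ (K - n)) (1 : B7Prop1Explicit.Site (F.P K).d → Fin (F.P K).d → (Matrix (Fin 2) (Fin 2) ℂ)ˣ)
            (pull R 0)) μ z‖ ≤ e₃) :
    ∃ (Ω : ℕ → Set (Site (F.P K) 0)) (u' : GaugeTransf (F.P K) 0 (Matrix.unitaryGroup (Fin 2) ℂ))
        (A' : GaugeField (F.P K) 0 (Matrix (Fin 2) (Fin 2) ℂ)),
        x ∈ Ω (K - n) ∧ (∀ b : PBond (F.P K) 0, IsSelfAdjoint (A' b)) ∧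
        (∀ j, j ≤ K - n → ∀ (z : B7Prop1Explicit.Site (F.P K).d) (μ : Fin (F.P K).d), SideTouches (pullDom Ω j) z μ →
          mgauge (cfgPull (F.P K) 1) (gaugePull (F.P K) u')⁻¹ (cfgPull (F.P K) (toUField U)) z μ =
            cfgExp (((F.L : ℝ)⁻¹) ^ (K - n)) (pull A' 0) z μ) ∧
        (∀ j, j ≤ K - n → Cond140 (F.P K).L (((F.L : ℝ)⁻¹) ^ (K - n)) α₂ j (pullDom Ω j) (cfgPull (F.P K) 1) (pull A' 0)) := by
  set q : ℝ := 1 / 4 * max (4 * C * B₀ * B₃ * ε₁) (ε₀ / 2) with hq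
  have hkm : K - n ≤ (F.P K).m + (F.P K).K := FlatMinimizerH.le_T3 F n K
  have hC : 0 ≤ C := by linarith
  have hLk : (0 : ℝ) < (F.L : ℝ) ^ (K - n) := by
    have : (0 : ℝ) < (F.L : ℝ) := by exact_mod_cast lt_trans zero_lt_one F.hL.2
    positivity
  have hη : ((((F.L : ℝ)⁻¹) ^ (K - n))⁻¹ : ℝ) = (F.L : ℝ) ^ (K - n) := by rw [inv_pow, inv_inv]
  -- the sizes of `B` in the currency of `matrixRows164_quarter_top` (`M_Δ = 1`, `r₀ = 1`), at a bond `b` one block from `Bᵏ(x)`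
  have hnear' : ∀ {b : PBond (F.P K) 0}, distSite (Mk (F.P K) (K - n)) (iterBlockOf (K - n) b.src) (iterBlockOf (K - n) x) ≤ 1 →
      ∀ c : BondIdx (cubeSeqMT3 F n K x ρ S M hM), (c.1.1 : ℕ) = K - n →
        c.1.2.src ∈ (cubeSeqMT3 F n K x ρ S M hM).Om (c.1.1 : ℕ) → c.1.2.tgt ∈ (cubeSeqMT3 F n K x ρ S M hM).Om (c.1.1 : ℕ) →
        ‖B c‖ ≤ C * 1 * ε₁ * (distBI (cubeSeqMT3 F n K x ρ S M hM) b c + 1) := by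
    intro b hb c hc hs ht
    have hd := HalvingDatum160.dist_le_distBI_add x ρ S M hM c hc hb
    have hD := HalvingQuarterCubeSeq.distBI_nonneg (cubeSeqMT3 F n K x ρ S M hM) b c
    have h1 : C₁ * ε₁ * (distBI (cubeSeqMT3 F n K x ρ S M hM) b c + 1 + 1) ≤ 2 * C₁ * (ε₁ * (distBI (cubeSeqMT3 F n K x ρ S M hM) b c + 1)) := by
      nlinarith [mul_nonneg (mul_nonneg hC₁ hε₁) hD]
    have h2 : 2 * C₁ * (ε₁ * (distBI (cubeSeqMT3 F n K x ρ S M hM) b c + 1)) ≤ C * (ε₁ * (distBI (cubeSeqMT3 F n K x ρ S M hM) b c + 1)) :=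
      mul_le_mul_of_nonneg_right hC₁C (mul_nonneg hε₁ (by linarith))
    calc ‖B c‖ ≤ C₁ * ε₁ * (distSite (Mk (F.P K) (c.1.1 : ℕ)) c.1.2.src (iterBlockOf (c.1.1 : ℕ) x) + 1) := hnear c hc hs ht
      _ ≤ C₁ * ε₁ * (distBI (cubeSeqMT3 F n K x ρ S M hM) b c + 1 + 1) := mul_le_mul_of_nonneg_left (by linarith) (by positivity)
      _ ≤ C * 1 * ε₁ * (distBI (cubeSeqMT3 F n K x ρ S M hM) b c + 1) := by rw [mul_one]; linarith
  have hfar' : ∀ c : BondIdx (cubeSeqMT3 F n K x ρ S M hM),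
      ¬ ((c.1.1 : ℕ) = K - n ∧ c.1.2.src ∈ (cubeSeqMT3 F n K x ρ S M hM).Om (c.1.1 : ℕ) ∧ c.1.2.tgt ∈ (cubeSeqMT3 F n K x ρ S M hM).Om (c.1.1 : ℕ)) →
      ‖B c‖ ≤ C * 1 * ε₀ * (F.L : ℝ) ^ ((K - n) - (c.1.1 : ℕ)) := by
    intro c hc
    have hLp : (0 : ℝ) ≤ (F.L : ℝ) ^ ((K - n) - (c.1.1 : ℕ)) := by positivity
    calc ‖B c‖ ≤ C₂ * ε₀ * (F.L : ℝ) ^ ((K - n) - (c.1.1 : ℕ)) := hfar c hc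
      _ ≤ C * 1 * ε₀ * (F.L : ℝ) ^ ((K - n) - (c.1.1 : ℕ)) := by
          rw [mul_one]; exact mul_le_mul_of_nonneg_right (mul_le_mul_of_nonneg_right hC₂C hε₀) hLp
  have hρ' : R₁M₁ ≤ (ρ : ℝ) - 1 - 1 := by linarith
  -- the three letters of `𝔄 = HB` at every bond one block from `Bᵏ(x)`
  have rows : ∀ {b : PBond (F.P K) 0}, distSite (Mk (F.P K) (K - n)) (iterBlockOf (K - n) b.src) (iterBlockOf (K - n) x) ≤ 1 →
      ‖𝔄 b‖ ≤ q ∧ (∀ κ : Fin 3, (F.L : ℝ) ^ (K - n) * ‖𝔄 ⟨b.src.shift κ, b.dir⟩ - 𝔄 b‖ ≤ q) ∧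
      ∀ (z : B7Prop1Explicit.Site (F.P K).d) (μ : Fin (F.P K).d), b = ⟨transl 0 z, μ⟩ →
        ‖pdiv (((F.L : ℝ)⁻¹) ^ (K - n)) (1 : B7Prop1Explicit.Site (F.P K).d → Fin (F.P K).d → (Matrix (Fin 2) (Fin 2) ℂ)ˣ)
            (plaqCovDeriv (((F.L : ℝ)⁻¹) ^ (K - n)) (1 : B7Prop1Explicit.Site (F.P K).d → Fin (F.P K).d → (Matrix (Fin 2) (Fin 2) ℂ)ˣ)
              (pull 𝔄 0)) μ z‖ ≤ q := by
    intro b hb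
    have h := matrixRows164_quarter_int hnK x ρ S M hM hw hdom hH h162 hδ₀ hB₀ hB₃ hC zero_le_one hε₁ hε₀ hR h163 hρ' h𝔄 hb
      (hnear' hb) hfar'
    simp only [mul_one] at h
    simpa [hq] using h
  -- the layer geometry: sources one block from `Bᵏ(x)`
  have hbS : ∀ {z : B7Prop1Explicit.Site (F.P K).d} {τ : Fin (F.P K).d},
      SideTouches (pullDom (fun j => if K - n ≤ j then ({x} : Set (Site (F.P K) 0)) else (∅ : Set (Site (F.P K) 0))) (K - n)) z τ →
      distSite (Mk (F.P K) (K - n)) (iterBlockOf (K - n) (⟨transl 0 z, τ⟩ : PBond (F.P K) 0).src) (iterBlockOf (K - n) x) ≤ 1 :=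
    fun hz => distSite_iterBlockOf_le_one_of_le_one hkm (dist_le_one_of_sideTouches x (K - n) hz)
  have hbB : ∀ {z : B7Prop1Explicit.Site (F.P K).d} {μ : Fin (F.P K).d},
      BondTouches (pullDom (fun j => if K - n ≤ j then ({x} : Set (Site (F.P K) 0)) else (∅ : Set (Site (F.P K) 0))) (K - n)) z μ →
      distSite (Mk (F.P K) (K - n)) (iterBlockOf (K - n) (⟨transl 0 z, μ⟩ : PBond (F.P K) 0).src) (iterBlockOf (K - n) x) ≤ 1 :=
    fun hz => distSite_iterBlockOf_le_one_of_le_one hkm (dist_le_one_of_bondTouches x (K - n) hz)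
  -- the `𝔄`-letters on the layers
  have s₂ : ∀ (z : B7Prop1Explicit.Site (F.P K).d) (τ : Fin (F.P K).d),
      SideTouches (pullDom (fun j => if K - n ≤ j then ({x} : Set (Site (F.P K) 0)) else (∅ : Set (Site (F.P K) 0))) (K - n)) z τ →
      ‖𝔄 ⟨transl 0 z, τ⟩‖ ≤ q :=
    fun z τ hz => (rows (hbS hz)).1
  have g₂ : ∀ (z : B7Prop1Explicit.Site (F.P K).d) (κ τ : Fin (F.P K).d),
      SideTouches (pullDom (fun j => if K - n ≤ j then ({x} : Set (Site (F.P K) 0)) else (∅ : Set (Site (F.P K) 0))) (K - n)) z τ →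
      ‖(((F.L : ℝ)⁻¹) ^ (K - n))⁻¹ • (𝔄 ⟨(transl 0 z).shift κ, τ⟩ - 𝔄 ⟨transl 0 z, τ⟩)‖ ≤ q := by
    intro z κ τ hz
    rw [hη, norm_smul, Real.norm_of_nonneg hLk.le]
    exact (rows (hbS hz)).2.1 κ
  have d₂ : ∀ (z : B7Prop1Explicit.Site (F.P K).d) (μ : Fin (F.P K).d),
      BondTouches (pullDom (fun j => if K - n ≤ j then ({x} : Set (Site (F.P K) 0)) else (∅ : Set (Site (F.P K) 0))) (K - n)) z μ →
      ‖pdiv (((F.L : ℝ)⁻¹) ^ (K - n)) (1 : B7Prop1Explicit.Site (F.P K).d → Fin (F.P K).d → (Matrix (Fin 2) (Fin 2) ℂ)ˣ)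
          (plaqCovDeriv (((F.L : ℝ)⁻¹) ^ (K - n)) (1 : B7Prop1Explicit.Site (F.P K).d → Fin (F.P K).d → (Matrix (Fin 2) (Fin 2) ℂ)ˣ)
            (pull 𝔄 0)) μ z‖ ≤ q :=
    fun z μ hz => (rows (hbB hz)).2.2 z μ rfl
  -- (159) ⇒ the three torus letters of `A` at threshold `α₂`
  obtain ⟨h1, h2, h3⟩ := torusBounds_of_decomp hdec (by linarith : e₁ + q + e₃ < α₂) _ s₁ s₂ s₃ g₁ g₂ g₃ d₁ d₂ d₃
  -- the socket's per-site clause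
  exact localChart_top_of_torus F n K x U {x} u A (Set.mem_singleton x) hA hchart h1 h2 h3

end Site

/-! ## §2 `H` from the P2 text and the interior package -/

section Member

variable {L R₀ M₀ : ℕ} {B₀ δ₀ B₃ : ℝ}

/-- **`H(L, 4CB₀B₃, K₁ + K₂ + 1, a)` FROM THE P2 TEXT AND THE INTERIOR PACKAGE** (see the module docstring; the package `pkg` is displayed in full below: per member
`F` with `F.L = L`, heights `n < K`, `0 < ε₁`, `0 < ε₀ ≤ a`, `4CB₀B₃ε₁ < ε₀`, (7)-datum `V`, minimiser `U` over (6)(ε₀) and site `x`, the pieces of (159) at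
`D := cubeSeqMT3 F n K x ρ S M`). [cite: Balaban1985Variational, (159) p.303, (164)-(167) p.304; Balaban1985RegularSpaces, (1.140) p.100] -/
theorem H_of_packageInt (hP2 : FlatOpsAdmAtMS L R₀ M₀ B₀ δ₀ B₃) (hB₀ : 0 ≤ B₀) (hδ₀ : 0 ≤ δ₀) (hB₃ : 0 ≤ B₃)
    {R M aₑ ρ S : ℕ} (hR : R₀ ≤ R) (hM₀ : M₀ ≤ M) (hMpow : M = L ^ aₑ) (hM1 : 1 ≤ M) (hRS : R * M ≤ S) (hρ2 : (2 : ℝ) ≤ (ρ : ℝ))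
    {C C₁ C₂ K₁ K₂ a : ℝ} (hC₁ : 0 ≤ C₁) (hC₁C : 2 * C₁ ≤ C) (hC₂C : C₂ ≤ C)
    (h163 : 4 * C * B₀ * B₃ * Real.exp (-(δ₀ / 2 * ((ρ : ℝ) - 2))) ≤ 1 / 2)
    (pkg : ∀ F : T3Family, F.L = L → ∀ (n K : ℕ) (hnK : n < K) (ε₀ ε₁ : ℝ), 0 < ε₁ → 0 < ε₀ → ε₀ ≤ a → 4 * C * B₀ * B₃ * ε₁ < ε₀ →
      ∀ V : GaugeField (F.P n) 0 (Matrix.specialUnitaryGroup (Fin 2) ℂ), PlaqSmall ε₁ V →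
        ∀ U ∈ regFibrePr F n K hnK.le ε₀ V,
          IsMinOn (fun W : GaugeField (F.P K) 0 (Matrix.specialUnitaryGroup (Fin 2) ℂ) => wilsonAction4 W) (regFibrePr F n K hnK.le ε₀ V) U →
          ∀ x : Site (F.P K) 0,
            ∃ (u : GaugeTransf (F.P K) 0 (Matrix.unitaryGroup (Fin 2) ℂ)) (A A₁ R : PBond (F.P K) 0 → Matrix (Fin 2) (Fin 2) ℂ)
              (B : BondIdx (cubeSeqMT3 F n K x ρ S M hM1) → Matrix (Fin 2) (Fin 2) ℂ),
              (∀ b : PBond (F.P K) 0, IsSelfAdjoint (A b)) ∧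
              (∀ (z : B7Prop1Explicit.Site (F.P K).d) (μ : Fin (F.P K).d),
                SideTouches (pullDom (fun j => if K - n ≤ j then ({x} : Set (Site (F.P K) 0)) else (∅ : Set (Site (F.P K) 0))) (K - n)) z μ →
                (Unitary.toUnits (u (transl 0 z)))⁻¹ * unitsField (toUField U) ⟨transl 0 z, μ⟩ * Unitary.toUnits (u ((transl 0 z).shift μ)) =
                  expUnit (I • ((((F.L : ℝ)⁻¹) ^ (K - n)) • A ⟨transl 0 z, μ⟩))) ∧
              (A = A₁ + (fun b => ∑ c, flatH F n K (cubeSeqMT3 F n K x ρ S M hM1) (Pi.single c 1) b • B c) - R) ∧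
              (∀ c : BondIdx (cubeSeqMT3 F n K x ρ S M hM1), (c.1.1 : ℕ) = K - n →
                c.1.2.src ∈ (cubeSeqMT3 F n K x ρ S M hM1).Om (c.1.1 : ℕ) → c.1.2.tgt ∈ (cubeSeqMT3 F n K x ρ S M hM1).Om (c.1.1 : ℕ) →
                ‖B c‖ ≤ C₁ * ε₁ * (distSite (Mk (F.P K) (c.1.1 : ℕ)) c.1.2.src (iterBlockOf (c.1.1 : ℕ) x) + 1)) ∧
              (∀ c : BondIdx (cubeSeqMT3 F n K x ρ S M hM1),
                ¬ ((c.1.1 : ℕ) = K - n ∧ c.1.2.src ∈ (cubeSeqMT3 F n K x ρ S M hM1).Om (c.1.1 : ℕ) ∧ c.1.2.tgt ∈ (cubeSeqMT3 F n K x ρ S M hM1).Om (c.1.1 : ℕ)) →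
                ‖B c‖ ≤ C₂ * ε₀ * (F.L : ℝ) ^ ((K - n) - (c.1.1 : ℕ))) ∧
              (∀ (z : B7Prop1Explicit.Site (F.P K).d) (τ : Fin (F.P K).d),
                SideTouches (pullDom (fun j => if K - n ≤ j then ({x} : Set (Site (F.P K) 0)) else (∅ : Set (Site (F.P K) 0))) (K - n)) z τ →
                ‖A₁ ⟨transl 0 z, τ⟩‖ ≤ K₁ * ε₀ ^ 2) ∧
              (∀ (z : B7Prop1Explicit.Site (F.P K).d) (κ τ : Fin (F.P K).d),
                SideTouches (pullDom (fun j => if K - n ≤ j then ({x} : Set (Site (F.P K) 0)) else (∅ : Set (Site (F.P K) 0))) (K - n)) z τ →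
                ‖(((F.L : ℝ)⁻¹) ^ (K - n))⁻¹ • (A₁ ⟨(transl 0 z).shift κ, τ⟩ - A₁ ⟨transl 0 z, τ⟩)‖ ≤ K₁ * ε₀ ^ 2) ∧
              (∀ (z : B7Prop1Explicit.Site (F.P K).d) (μ : Fin (F.P K).d),
                BondTouches (pullDom (fun j => if K - n ≤ j then ({x} : Set (Site (F.P K) 0)) else (∅ : Set (Site (F.P K) 0))) (K - n)) z μ →
                ‖pdiv (((F.L : ℝ)⁻¹) ^ (K - n)) (1 : B7Prop1Explicit.Site (F.P K).d → Fin (F.P K).d → (Matrix (Fin 2) (Fin 2) ℂ)ˣ)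
                    (plaqCovDeriv (((F.L : ℝ)⁻¹) ^ (K - n)) (1 : B7Prop1Explicit.Site (F.P K).d → Fin (F.P K).d → (Matrix (Fin 2) (Fin 2) ℂ)ˣ)
                      (pull A₁ 0)) μ z‖ ≤ K₁ * ε₀ ^ 2) ∧
              (∀ (z : B7Prop1Explicit.Site (F.P K).d) (τ : Fin (F.P K).d),
                SideTouches (pullDom (fun j => if K - n ≤ j then ({x} : Set (Site (F.P K) 0)) else (∅ : Set (Site (F.P K) 0))) (K - n)) z τ →
                ‖R ⟨transl 0 z, τ⟩‖ ≤ K₂ * ε₀ ^ 2) ∧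
              (∀ (z : B7Prop1Explicit.Site (F.P K).d) (κ τ : Fin (F.P K).d),
                SideTouches (pullDom (fun j => if K - n ≤ j then ({x} : Set (Site (F.P K) 0)) else (∅ : Set (Site (F.P K) 0))) (K - n)) z τ →
                ‖(((F.L : ℝ)⁻¹) ^ (K - n))⁻¹ • (R ⟨(transl 0 z).shift κ, τ⟩ - R ⟨transl 0 z, τ⟩)‖ ≤ K₂ * ε₀ ^ 2) ∧
              (∀ (z : B7Prop1Explicit.Site (F.P K).d) (μ : Fin (F.P K).d),
                BondTouches (pullDom (fun j => if K - n ≤ j then ({x} : Set (Site (F.P K) 0)) else (∅ : Set (Site (F.P K) 0))) (K - n)) z μ →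
                ‖pdiv (((F.L : ℝ)⁻¹) ^ (K - n)) (1 : B7Prop1Explicit.Site (F.P K).d → Fin (F.P K).d → (Matrix (Fin 2) (Fin 2) ℂ)ˣ)
                    (plaqCovDeriv (((F.L : ℝ)⁻¹) ^ (K - n)) (1 : B7Prop1Explicit.Site (F.P K).d → Fin (F.P K).d → (Matrix (Fin 2) (Fin 2) ℂ)ˣ)
                      (pull R 0)) μ z‖ ≤ K₂ * ε₀ ^ 2)) :
    ∀ F : T3Family, F.L = L → ∀ (n K' : ℕ) (hnK : n < K') (ε₀ ε₁ : ℝ), 0 < ε₁ → 0 < ε₀ → ε₀ ≤ a → 4 * C * B₀ * B₃ * ε₁ < ε₀ →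
      ∀ V : GaugeField (F.P n) 0 (Matrix.specialUnitaryGroup (Fin 2) ℂ), PlaqSmall ε₁ V →
        ∀ U ∈ regFibrePr F n K' hnK.le ε₀ V,
          IsMinOn (fun W : GaugeField (F.P K') 0 (Matrix.specialUnitaryGroup (Fin 2) ℂ) => wilsonAction4 W) (regFibrePr F n K' hnK.le ε₀ V) U →
          ∀ x : Site (F.P K') 0, ∃ (Ω : ℕ → Set (Site (F.P K') 0)) (u : GaugeTransf (F.P K') 0 (Matrix.unitaryGroup (Fin 2) ℂ))
            (A : GaugeField (F.P K') 0 (Matrix (Fin 2) (Fin 2) ℂ)),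
            x ∈ Ω (K' - n) ∧ (∀ b : PBond (F.P K') 0, IsSelfAdjoint (A b)) ∧
            (∀ j, j ≤ K' - n → ∀ (z : B7Prop1Explicit.Site (F.P K').d) (μ : Fin (F.P K').d), SideTouches (pullDom Ω j) z μ →
              mgauge (cfgPull (F.P K') 1) (gaugePull (F.P K') u)⁻¹ (cfgPull (F.P K') (toUField U)) z μ =
                cfgExp (((F.L : ℝ)⁻¹) ^ (K' - n)) (pull A 0) z μ) ∧
            (∀ j, j ≤ K' - n → Cond140 (F.P K').L (((F.L : ℝ)⁻¹) ^ (K' - n)) (1 / 4 * max (4 * C * B₀ * B₃ * ε₁) (ε₀ / 2) + (K₁ + K₂ + 1) * ε₀ ^ 2) j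
              (pullDom Ω j) (cfgPull (F.P K') 1) (pull A 0)) := by
  intro F hF n K hnK ε₀ ε₁ hε₁ hε₀ hε₀a hreg V hV U hU hmin x
  obtain ⟨u, A, A₁, Rm, B, hA, hchart, hdec, hnear, hfar, s₁, g₁, d₁, s₃, g₃, d₃⟩ :=
    pkg F hF n K hnK ε₀ ε₁ hε₁ hε₀ hε₀a hreg V hV U hU hmin x
  -- P2 at the cube sequence centred at `x`, with the canonical level weights
  have hAdm : Adm22 (cubeSeqMT3 F n K x ρ S M hM1) R M := adm22_cubeSeqMT3 F n K x ρ hM1 hRS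
  have hw : IsLevWeight F n K (cubeSeqMT3 F n K x ρ S M hM1)
      (fun m b => ((F.L : ℝ) ^ levOf (fun j => {y : Site (F.P K) 0 | (cubeSeqMT3 F n K x ρ S M hM1).InOm j y}) (K - n) b.src *
        ((F.L : ℝ)⁻¹) ^ (K - n)) ^ m) := fun _ _ => rfl
  obtain ⟨H, Gt, hFH, -, -, -, -, dBI, hdom, h162, hHd⟩ :=
    hP2 F hF n K hnK R M hR hM₀ ⟨aₑ, hMpow⟩ (cubeSeqMT3 F n K x ρ S M hM1) rfl hAdm _ hw
  -- the text's `H` IS the canonical `flatH`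
  have hHeq : H = flatH F n K (cubeSeqMT3 F n K x ρ S M hM1) :=
    LinearMap.ext fun X => funext fun b => (hFH X b).trans (isFlatH_flatH (F := F) (n := n) (K := K) (D := cubeSeqMT3 F n K x ρ S M hM1) X b).symm
  rw [hHeq] at hHd
  -- the per-site clause
  have hC : 0 ≤ C := by linarith
  have hε₀2 : 0 < ε₀ ^ 2 := by positivity
  exact siteClause_of_pieces_int hnK x ρ S M hM1 hw hdom hHd h162 hδ₀ hB₀ hB₃ hC₁ hC₁C hC₂C hε₁.le hε₀.le (by linarith) h163 le_rfl
    (by nlinarith) U u hA hchart (fun _ => rfl) hdec hnear hfar s₁ g₁ d₁ s₃ g₃ d₃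

end Member

/-! ## §3 The registered stub's text from the P2 text and the interior package at every large radius -/

/-- **THE REGISTERED TEXT FROM THE P2 TEXT AND THE INTERIOR PACKAGE AT EVERY LARGE RADIUS** — THE FORM THE PILLAR PENS SHOULD TARGET: the P2 text with `δ₀ > 0`, the
constants, and the analytic package for EVERY inner radius `ρ ≥ 2` of the cube sequence (print's Thm 2 / Sect. F work at any `R₁M₁`); (163) is then a
choice made here (`exists_rho_163` with `T = 4CB₀B₃`). [cite: Balaban1985Variational, (162)-(163) p.303, Sect. F p.304 before Prop. 8] -/
theorem stubText_of_packageInt_largeRho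
    (h : ∀ L : ℕ, 1 < L → ∃ (R₀ M₀ : ℕ) (B₀ δ₀ B₃ : ℝ), 0 ≤ B₀ ∧ 0 < δ₀ ∧ 0 ≤ B₃ ∧ FlatOpsAdmAtMS L R₀ M₀ B₀ δ₀ B₃ ∧
      ∃ (R M aₑ S : ℕ) (hM1 : 1 ≤ M) (C C₁ C₂ K₁ K₂ a : ℝ), R₀ ≤ R ∧ M₀ ≤ M ∧ M = L ^ aₑ ∧ R * M ≤ S ∧
        0 ≤ C₁ ∧ 2 * C₁ ≤ C ∧ C₂ ≤ C ∧ 0 ≤ K₁ ∧ 0 ≤ K₂ ∧ 0 < a ∧ 1 < C * B₀ * B₃ ∧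
        ∀ ρ : ℕ, (2 : ℝ) ≤ (ρ : ℝ) →
          ∀ F : T3Family, F.L = L → ∀ (n K : ℕ) (hnK : n < K) (ε₀ ε₁ : ℝ), 0 < ε₁ → 0 < ε₀ → ε₀ ≤ a → 4 * C * B₀ * B₃ * ε₁ < ε₀ →
            ∀ V : GaugeField (F.P n) 0 (Matrix.specialUnitaryGroup (Fin 2) ℂ), PlaqSmall ε₁ V →
              ∀ U ∈ regFibrePr F n K hnK.le ε₀ V,
                IsMinOn (fun W : GaugeField (F.P K) 0 (Matrix.specialUnitaryGroup (Fin 2) ℂ) => wilsonAction4 W) (regFibrePr F n K hnK.le ε₀ V) U →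
                ∀ x : Site (F.P K) 0,
                  ∃ (u : GaugeTransf (F.P K) 0 (Matrix.unitaryGroup (Fin 2) ℂ)) (A A₁ R : PBond (F.P K) 0 → Matrix (Fin 2) (Fin 2) ℂ)
                    (B : BondIdx (cubeSeqMT3 F n K x ρ S M hM1) → Matrix (Fin 2) (Fin 2) ℂ),
                    (∀ b : PBond (F.P K) 0, IsSelfAdjoint (A b)) ∧
                    (∀ (z : B7Prop1Explicit.Site (F.P K).d) (μ : Fin (F.P K).d),
                      SideTouches (pullDom (fun j => if K - n ≤ j then ({x} : Set (Site (F.P K) 0)) else (∅ : Set (Site (F.P K) 0))) (K - n)) z μ →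
                      (Unitary.toUnits (u (transl 0 z)))⁻¹ * unitsField (toUField U) ⟨transl 0 z, μ⟩ * Unitary.toUnits (u ((transl 0 z).shift μ)) =
                        expUnit (I • ((((F.L : ℝ)⁻¹) ^ (K - n)) • A ⟨transl 0 z, μ⟩))) ∧
                    (A = A₁ + (fun b => ∑ c, flatH F n K (cubeSeqMT3 F n K x ρ S M hM1) (Pi.single c 1) b • B c) - R) ∧
                    (∀ c : BondIdx (cubeSeqMT3 F n K x ρ S M hM1), (c.1.1 : ℕ) = K - n →
                      c.1.2.src ∈ (cubeSeqMT3 F n K x ρ S M hM1).Om (c.1.1 : ℕ) → c.1.2.tgt ∈ (cubeSeqMT3 F n K x ρ S M hM1).Om (c.1.1 : ℕ) →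
                      ‖B c‖ ≤ C₁ * ε₁ * (distSite (Mk (F.P K) (c.1.1 : ℕ)) c.1.2.src (iterBlockOf (c.1.1 : ℕ) x) + 1)) ∧
                    (∀ c : BondIdx (cubeSeqMT3 F n K x ρ S M hM1),
                      ¬ ((c.1.1 : ℕ) = K - n ∧ c.1.2.src ∈ (cubeSeqMT3 F n K x ρ S M hM1).Om (c.1.1 : ℕ) ∧ c.1.2.tgt ∈ (cubeSeqMT3 F n K x ρ S M hM1).Om (c.1.1 : ℕ)) →
                      ‖B c‖ ≤ C₂ * ε₀ * (F.L : ℝ) ^ ((K - n) - (c.1.1 : ℕ))) ∧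
                    (∀ (z : B7Prop1Explicit.Site (F.P K).d) (τ : Fin (F.P K).d),
                      SideTouches (pullDom (fun j => if K - n ≤ j then ({x} : Set (Site (F.P K) 0)) else (∅ : Set (Site (F.P K) 0))) (K - n)) z τ →
                      ‖A₁ ⟨transl 0 z, τ⟩‖ ≤ K₁ * ε₀ ^ 2) ∧
                    (∀ (z : B7Prop1Explicit.Site (F.P K).d) (κ τ : Fin (F.P K).d),
                      SideTouches (pullDom (fun j => if K - n ≤ j then ({x} : Set (Site (F.P K) 0)) else (∅ : Set (Site (F.P K) 0))) (K - n)) z τ →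
                      ‖(((F.L : ℝ)⁻¹) ^ (K - n))⁻¹ • (A₁ ⟨(transl 0 z).shift κ, τ⟩ - A₁ ⟨transl 0 z, τ⟩)‖ ≤ K₁ * ε₀ ^ 2) ∧
                    (∀ (z : B7Prop1Explicit.Site (F.P K).d) (μ : Fin (F.P K).d),
                      BondTouches (pullDom (fun j => if K - n ≤ j then ({x} : Set (Site (F.P K) 0)) else (∅ : Set (Site (F.P K) 0))) (K - n)) z μ →
                      ‖pdiv (((F.L : ℝ)⁻¹) ^ (K - n)) (1 : B7Prop1Explicit.Site (F.P K).d → Fin (F.P K).d → (Matrix (Fin 2) (Fin 2) ℂ)ˣ)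
                          (plaqCovDeriv (((F.L : ℝ)⁻¹) ^ (K - n)) (1 : B7Prop1Explicit.Site (F.P K).d → Fin (F.P K).d → (Matrix (Fin 2) (Fin 2) ℂ)ˣ)
                            (pull A₁ 0)) μ z‖ ≤ K₁ * ε₀ ^ 2) ∧
                    (∀ (z : B7Prop1Explicit.Site (F.P K).d) (τ : Fin (F.P K).d),
                      SideTouches (pullDom (fun j => if K - n ≤ j then ({x} : Set (Site (F.P K) 0)) else (∅ : Set (Site (F.P K) 0))) (K - n)) z τ →
                      ‖R ⟨transl 0 z, τ⟩‖ ≤ K₂ * ε₀ ^ 2) ∧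
                    (∀ (z : B7Prop1Explicit.Site (F.P K).d) (κ τ : Fin (F.P K).d),
                      SideTouches (pullDom (fun j => if K - n ≤ j then ({x} : Set (Site (F.P K) 0)) else (∅ : Set (Site (F.P K) 0))) (K - n)) z τ →
                      ‖(((F.L : ℝ)⁻¹) ^ (K - n))⁻¹ • (R ⟨(transl 0 z).shift κ, τ⟩ - R ⟨transl 0 z, τ⟩)‖ ≤ K₂ * ε₀ ^ 2) ∧
                    (∀ (z : B7Prop1Explicit.Site (F.P K).d) (μ : Fin (F.P K).d),
                      BondTouches (pullDom (fun j => if K - n ≤ j then ({x} : Set (Site (F.P K) 0)) else (∅ : Set (Site (F.P K) 0))) (K - n)) z μ →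
                      ‖pdiv (((F.L : ℝ)⁻¹) ^ (K - n)) (1 : B7Prop1Explicit.Site (F.P K).d → Fin (F.P K).d → (Matrix (Fin 2) (Fin 2) ℂ)ˣ)
                          (plaqCovDeriv (((F.L : ℝ)⁻¹) ^ (K - n)) (1 : B7Prop1Explicit.Site (F.P K).d → Fin (F.P K).d → (Matrix (Fin 2) (Fin 2) ℂ)ˣ)
                            (pull R 0)) μ z‖ ≤ K₂ * ε₀ ^ 2)) :
    ∀ (L : ℕ), 1 < L → ∃ B₃ : ℝ, 4 < B₃ ∧ ∃ a₅ : ℝ, 0 < a₅ ∧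
      ∀ (i : Idx L) (ε₀ ε₁ : ℝ), 0 < ε₁ → ∀ (V : (famX L i).Bdry) (U : (famX L i).Cfg), (famX L i).Reg7 ε₁ V → (famX L i).InU ε₀ U →
        (famX L i).InB V U → (famX L i).IsCritical V U → ε₀ ≤ a₅ → (famX L i).InU (max (B₃ * ε₁) (ε₀ / 2)) U := by
  refine Prop8LastMile.stubText_of_localCharts167 fun L hL => ?_
  obtain ⟨R₀, M₀, B₀, δ₀, B₃, hB₀, hδ₀, hB₃, hP2, R, M, aₑ, S, hM1, C, C₁, C₂, K₁, K₂, a, hR, hM₀, hMpow, hRS, hC₁, hC₁C, hC₂C, hK₁, hK₂,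
    ha, hbig, pkg⟩ := h L hL
  have hC : 0 ≤ C := by linarith
  obtain ⟨ρ, hρ2, h163⟩ := HalvingAssembly.exists_rho_163 hδ₀ (by positivity : (0 : ℝ) ≤ 4 * C * B₀ * B₃)
  refine ⟨4 * C * B₀ * B₃, by nlinarith, K₁ + K₂ + 1, by positivity, a, ha, ?_⟩
  exact H_of_packageInt hP2 hB₀ hδ₀.le hB₃ hR hM₀ hMpow hM1 hRS hρ2 hC₁ hC₁C hC₂C h163 (pkg ρ hρ2)

end Summit.QuantumFields.YangMills.Theorems.HalvingAssemblyInterior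

end
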